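import Summits.AnomalousDissipation.AnomalousDissipation.Theorems.MomentParityQuarticGateAtoms
import Summits.AnomalousDissipation.AnomalousDissipation.Theorems.MomentParityQuarticGateRowPoly
import Summits.AnomalousDissipation.AnomalousDissipation.Theorems.MomentParityQuarticGateBudget
import Summits.AnomalousDissipation.AnomalousDissipation.Theorems.MomentParityQuarticGateStability
import Summits.AnomalousDissipation.AnomalousDissipation.Theorems.QuarticGate.Negative.LevelCeiling

/-!
# Exact far-atom surgery at order 4 — stub `stub_surgery` (S4) of the line `recession-cone` for
`MomentParity.QuarticGate` (stmt-AnomalousDissipation-11464)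

A level-`N` probability law `μ₀` with finite fourth moments whose degree-4 Riesz functional is
STRICTLY positive on level-`N` fields (band-form Slater), 3-stationary at `(ν, f, N)`, together
with a defect certificate `(vₗ, cₗ)` for the cubic rows, yields a level-`N` probability law `μ`
with finite fourth moments which is 4-STATIONARY and has the same mean energy and dissipation.

Construction (in an orthonormal band basis `b` of `V_N`, `exists_bandBasis`): with
`y_α = ∫ x^α dμ₀` the coordinate moments (strictly positive: `isStrictlyKPositive_of_slater`),
`w = R⁻⁴ Σ cₗ`, `xₗ` the coordinates of `vₗ`, and the modified sequence
`y'_α = [y_α − 1_{|α|=2} R⁻² Σₗ cₗ xₗ^α]/(1 − w)` (`y'_0 = 1`) — strictly positive for `R ≫ 1`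
(`exists_isStrictlyKPositive_nhds`, `exists_surgery_radius`) — REALIZE a level-`N` law `μ₁` with
moments `y'` (`exists_measure_of_strictlyKPositive`, Fialkow–Nie Thm. 1.3) and set
`μ = (1 − w) μ₁ + Σₗ cₗ/(2R⁴) (δ_{R vₗ} + δ_{−R vₗ})`. Then `∫ Q dμ = L_y(Q) + Σₗ cₗ Q₄(xₗ)` for
every coordinate polynomial of degree `≤ 4` (`surgery_rieszFunctional`): rows of tests of degree
`≤ 2` are those of `μ₀` (`= 0`), cubic rows are shifted by exactly the certificate (row polynomial
and its top component, `exists_rowPoly`), energy and dissipation are quadratic (`…Budget`).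

The theorem is proved as `farAtomSurgery`, stated through the vocabulary `IsLevel` / `IsBandTest` /
`polyGrad` / `IsPolyStationary` of `Theorems/QuarticGate/Negative/LevelCeiling.lean` (definitional
unfoldings of the crux clauses; this short form is the registered sub-goal, the skeleton's own
registration of `stub_surgery` being truncated), and `stub_surgery` (verbatim skeleton signature)
follows by definitional unfolding.
-/

namespace Summit.AnomalousDissipation.AnomalousDissipation.Theorems.MomentParityQuarticGate

open MeasureTheory Filter
open scoped InnerProductSpace RealInnerProductSpace ENNReal
open Literature.Analysis.FunctionSpaces Literature.Analysis.FluidPDE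
open Literature.MeasureTheory.Moments
open Summit.AnomalousDissipation.AnomalousDissipation.Theses.MomentParity
open Summit.AnomalousDissipation.AnomalousDissipation.Theorems.QuarticGate.Negative

set_option linter.dupNamespace false

/-- **Exact far-atom surgery at order 4** (= `stub_surgery` below, stated through the vocabulary
`IsLevel` / `IsBandTest` / `polyGrad` / `IsPolyStationary` of `Theorems/QuarticGate/Negative/LevelCeiling.lean`,
which unfolds definitionally to the crux clauses; registered sub-goal `farAtomSurgery` of
stmt-AnomalousDissipation-11464). [folklore] -/
theorem farAtomSurgery :
    ∀ (ν : ℝ) (f : UnitAddTorus (Fin 3) → EuclideanSpace ℝ (Fin 3)) (N : ℕ) (μ₀ : Measure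
      (Torus.energySpace (Fin 3))), Torus.IsSmooth f → IsProbabilityMeasure μ₀ → (∀ᵐ u ∂μ₀, IsLevel
      N u) → Integrable (fun u : Torus.energySpace (Fin 3) => ‖u‖ ^ 4) μ₀ → (∀ (m : ℕ) (g : Fin m →
      UnitAddTorus (Fin 3) → EuclideanSpace ℝ (Fin 3)) (P : MvPolynomial (Fin m) ℝ), (∀ i,
      IsBandTest N (g i)) → P.totalDegree ≤ 4 → (∀ u : Torus.energySpace (Fin 3), IsLevel N u → 0 ≤
      MvPolynomial.eval (fun j => Torus.pairing u.1 (g j)) P) → (∃ u : Torus.energySpace (Fin 3),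
      IsLevel N u ∧ MvPolynomial.eval (fun j => Torus.pairing u.1 (g j)) P ≠ 0) → 0 < ∫ u,
      MvPolynomial.eval (fun j => Torus.pairing u.1 (g j)) P ∂μ₀) → IsPolyStationary ν f N 3 μ₀ → ∀
      (M : ℕ) (v : Fin M → Torus.energySpace (Fin 3)) (c : Fin M → ℝ), ((∀ l, IsLevel N (v l)) ∧ (∀
      l, 0 ≤ c l) ∧ ∀ (m : ℕ) (g : Fin m → UnitAddTorus (Fin 3) → EuclideanSpace ℝ (Fin 3)) (P :
      MvPolynomial (Fin m) ℝ), (∀ i, IsBandTest N (g i)) → P.IsHomogeneous 3 → ∫ u,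
      Torus.nsGeneratorPairing ν f u (polyGrad g P u) ∂μ₀ + ∑ l, c l * Torus.nsGeneratorPairing
      (d := Fin 3) 0 0 (v l) (polyGrad g P (v l)) = 0) → ∃ μ : Measure (Torus.energySpace (Fin 3)),
      IsProbabilityMeasure μ ∧ (∀ᵐ u ∂μ, IsLevel N u) ∧ Integrable (fun u : Torus.energySpace (Fin
      3) => ‖u‖ ^ 4) μ ∧ IsPolyStationary ν f N 4 μ ∧ Torus.ensembleEnergy μ = Torus.ensembleEnergy
      μ₀ ∧ Torus.ensembleDissipation ν μ = Torus.ensembleDissipation ν μ₀ := by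
  intro ν f N μ₀ hf hμ₀ hlev₀ h4₀ hS hst M v c hcert
  obtain ⟨hv, hc, hcert⟩ := hcert
  classical
  -- an orthonormal band basis and the coordinate moments of `μ₀`
  obtain ⟨n, b, hb, hbo, hbs⟩ := exists_bandBasis N
  have hypos := isStrictlyKPositive_of_slater hb hbo μ₀ inferInstance h4₀ hS
  generalize hy_def : (fun α : Fin n →₀ ℕ => ∫ u, ∏ i, (Torus.pairing u.1 (b i)) ^ α i ∂μ₀) = y
    at hypos
  have hy0 : y 0 = 1 := by
    rw [← hy_def]
    simp
  obtain ⟨ε, hε, hopen⟩ := exists_isStrictlyKPositive_nhds hypos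
  -- the radius
  obtain ⟨R, hR1, hwR, hnear⟩ :=
    exists_surgery_radius y hy0 c (fun l i => Torus.pairing (v l).1 (b i)) hε
  have hR0 : R ≠ 0 := (zero_lt_one.trans_le hR1).ne'
  have hC0 : 0 ≤ ∑ l, c l := Finset.sum_nonneg fun l _ => hc l
  have hw0 : 0 ≤ (∑ l, c l) / R ^ 4 := by positivity
  have hw_le : (∑ l, c l) / R ^ 4 ≤ 1 / 2 := (le_abs_self _).trans hwR
  have hw1 : (∑ l, c l) / R ^ 4 ≠ 1 := by
    intro h
    linarith
  have h1w : 0 ≤ 1 - (∑ l, c l) / R ^ 4 := by linarith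
  -- the modified moment sequence and its realisation
  have hy' := hopen (fun α => if α = 0 then 1 else
      (y α - if α.degree = 2 then (∑ l, c l * ∏ i, Torus.pairing (v l).1 (b i) ^ α i) / R ^ 2
        else 0) / (1 - (∑ l, c l) / R ^ 4)) hnear
  obtain ⟨μ₁, hμ₁, hlev₁, h4₁, hmom₁⟩ :=
    exists_measure_of_strictlyKPositive hb hbo _ (by simp) hy'
  -- the surgery law `μ = (1 - w) μ₁ + Σₗ cₗ/(2R⁴) (δ_{R vₗ} + δ_{-R vₗ})`
  have hq0 : ∀ l, 0 ≤ c l / (2 * R ^ 4) := fun l => by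
    have := hc l
    positivity
  have hsum : (1 - (∑ l, c l) / R ^ 4) + ∑ l, 2 * (c l / (2 * R ^ 4)) = 1 := by
    have h2 : ∀ l, 2 * (c l / (2 * R ^ 4)) = c l / R ^ 4 := fun l => by
      field_simp
    simp_rw [h2, ← Finset.sum_div]
    ring
  generalize hμ_def : ENNReal.ofReal (1 - (∑ l, c l) / R ^ 4) • μ₁ +
      ∑ l, ENNReal.ofReal (c l / (2 * R ^ 4)) •
        (Measure.dirac (R • v l) + Measure.dirac ((-R) • v l)) = μ
  have hprob : IsProbabilityMeasure μ := by
    rw [← hμ_def]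
    exact isProbabilityMeasure_composite μ₁ h1w hq0 hsum _ _
  have hlevμ : ∀ᵐ u ∂μ, ∀ k ∉ (Torus.freqBall N).erase (0 : Fin 3 → ℤ),
      UnitAddTorus.mFourierCoeff (EuclideanSpace.complexify ∘
        (u.1 : UnitAddTorus (Fin 3) → EuclideanSpace ℝ (Fin 3))) k = 0 := by
    rw [← hμ_def]
    exact ae_composite hlev₁ (fun l => level_smul R (hv l)) fun l => level_smul (-R) (hv l)
  have h4μ : Integrable (fun u : Torus.energySpace (Fin 3) => ‖u‖ ^ 4) μ := by
    rw [← hμ_def]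
    exact integrable_composite h4₁
  -- KEY: moments of coordinate polynomials of degree ≤ 4 under `μ`
  have hkey : ∀ Q : MvPolynomial (Fin n) ℝ, Q.totalDegree ≤ 4 →
      ∫ u, MvPolynomial.eval (fun i => Torus.pairing u.1 (b i)) Q ∂μ =
        rieszFunctional y Q + ∑ l, c l * MvPolynomial.eval (fun i => Torus.pairing (v l).1 (b i))
          (MvPolynomial.homogeneousComponent 4 Q) := by
    intro Q hQ
    rw [← hμ_def, integral_composite h1w hq0 _ _ (hmom₁ Q hQ).1, (hmom₁ Q hQ).2]
    simp_rw [coords_smul hb]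
    exact surgery_rieszFunctional y hy0 c (fun l i => Torus.pairing (v l).1 (b i)) hR0 hw1 Q hQ
  -- integrals of coordinate polynomials under `μ₀` are `L_y`
  have hkey₀ : ∀ Q : MvPolynomial (Fin n) ℝ, Q.totalDegree ≤ 4 →
      ∫ u, MvPolynomial.eval (fun i => Torus.pairing u.1 (b i)) Q ∂μ₀ = rieszFunctional y Q := by
    intro Q hQ
    rw [(integrable_eval_coords_of_four hb hbo h4₀ Q hQ).2, hy_def]
  -- ROWS of tests of degree ≤ 3: integrable under `μ` and `μ₀`, shifted by the Euler pairings
  have hrow : ∀ (m : ℕ) (g : Fin m → UnitAddTorus (Fin 3) → EuclideanSpace ℝ (Fin 3))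
      (P : MvPolynomial (Fin m) ℝ),
      (∀ i, (Torus.IsSmooth (g i) ∧ Torus.IsDivFree (g i) ∧ Torus.HasZeroMean (g i) ∧
        ∀ k ∉ (Torus.freqBall N).erase (0 : Fin 3 → ℤ),
          UnitAddTorus.mFourierCoeff (EuclideanSpace.complexify ∘ (g i)) k = 0)) →
      P.totalDegree ≤ 3 →
      Integrable (fun u : Torus.energySpace (Fin 3) => Torus.nsGeneratorPairing ν f u
          (fun x => ∑ i, (MvPolynomial.eval (fun j => Torus.pairing u.1 (g j))
            (MvPolynomial.pderiv i P)) • g i x)) μ ∧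
      Integrable (fun u : Torus.energySpace (Fin 3) => Torus.nsGeneratorPairing ν f u
          (fun x => ∑ i, (MvPolynomial.eval (fun j => Torus.pairing u.1 (g j))
            (MvPolynomial.pderiv i P)) • g i x)) μ₀ ∧
      ∫ u, Torus.nsGeneratorPairing ν f u
          (fun x => ∑ i, (MvPolynomial.eval (fun j => Torus.pairing u.1 (g j))
            (MvPolynomial.pderiv i P)) • g i x) ∂μ =
        ∫ u, Torus.nsGeneratorPairing ν f u
          (fun x => ∑ i, (MvPolynomial.eval (fun j => Torus.pairing u.1 (g j))
            (MvPolynomial.pderiv i P)) • g i x) ∂μ₀ +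
        ∑ l, c l * Torus.nsGeneratorPairing (d := Fin 3) 0 0 (v l)
          (fun x => ∑ i, (MvPolynomial.eval (fun j => Torus.pairing (v l).1 (g j))
            (MvPolynomial.pderiv i (MvPolynomial.homogeneousComponent 3 P))) • g i x) := by
    intro m g P hg hP
    obtain ⟨Q, hQdeg, hQrow, hQtop⟩ := exists_rowPoly hb hbo hbs ν f hf m g hg P 3 hP
    haveI := hprob
    obtain ⟨hint, hI⟩ := integrable_of_eval_of_level hb hbo hlevμ h4μ hQdeg hQrow
    obtain ⟨hint₀, hI₀⟩ := integrable_of_eval_of_level hb hbo hlev₀ h4₀ hQdeg hQrow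
    refine ⟨hint, hint₀, ?_⟩
    rw [hI, hkey Q hQdeg, hI₀, hkey₀ Q hQdeg]
    congr 1
    exact Finset.sum_congr rfl fun l _ => by rw [hQtop (v l) (hv l)]
  haveI := hprob
  refine ⟨μ, hprob, hlevμ, h4μ, fun m g P hg hP => ?_, ?_, ?_⟩
  · -- 4-stationarity
    have hP3 : P.totalDegree ≤ 3 := by omega
    obtain ⟨hint, -, hval⟩ := hrow m g P hg hP3
    refine ⟨hint, ?_⟩
    show ∫ u, Torus.nsGeneratorPairing ν f u
        (fun x => ∑ i, (MvPolynomial.eval (fun j => Torus.pairing u.1 (g j))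
          (MvPolynomial.pderiv i P)) • g i x) ∂μ = 0
    rw [hval]
    -- split `P = P₃ + (P - P₃)` under `μ₀`
    have hP₃h := MvPolynomial.homogeneousComponent_isHomogeneous 3 P
    obtain ⟨-, hint₃, -⟩ := hrow m g (MvPolynomial.homogeneousComponent 3 P) hg hP₃h.totalDegree_le
    have hlow : (P - MvPolynomial.homogeneousComponent 3 P).totalDegree + 1 ≤ 3 := by
      have := totalDegree_sub_homogeneousComponent_le hP3
      omega
    obtain ⟨hintl, hzerol⟩ := hst m g (P - MvPolynomial.homogeneousComponent 3 P) hg hlow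
    replace hintl : Integrable (fun u : Torus.energySpace (Fin 3) => Torus.nsGeneratorPairing ν f u
        (fun x => ∑ i, (MvPolynomial.eval (fun j => Torus.pairing u.1 (g j))
          (MvPolynomial.pderiv i (P - MvPolynomial.homogeneousComponent 3 P))) • g i x)) μ₀ := hintl
    replace hzerol : ∫ u, Torus.nsGeneratorPairing ν f u
        (fun x => ∑ i, (MvPolynomial.eval (fun j => Torus.pairing u.1 (g j))
          (MvPolynomial.pderiv i (P - MvPolynomial.homogeneousComponent 3 P))) • g i x) ∂μ₀ = 0 :=
      hzerol
    have hsplit := fun u : Torus.energySpace (Fin 3) =>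
      row_eq_add_of_sub ν hf.integrable (fun i => (hg i).1) P (MvPolynomial.homogeneousComponent 3 P) u
    rw [integral_congr_ae (ae_of_all _ hsplit), integral_add hint₃ hintl, hzerol, add_zero]
    exact hcert m g _ hg hP₃h
  · -- mean energy
    rw [ensembleEnergy_eq_integral_sum_sq hb hbo hbs hlevμ,
      ensembleEnergy_eq_integral_sum_sq hb hbo hbs hlev₀]
    have hE : ∀ u : Torus.energySpace (Fin 3), ∑ i, (Torus.pairing u.1 (b i)) ^ 2 =
        MvPolynomial.eval (fun i => Torus.pairing u.1 (b i))
          (∑ i : Fin n, (MvPolynomial.X i ^ 2 : MvPolynomial (Fin n) ℝ)) := fun u => by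
      simp [map_sum, map_pow]
    have hdeg2 : (∑ i : Fin n, (MvPolynomial.X i ^ 2 : MvPolynomial (Fin n) ℝ)).totalDegree ≤ 2 :=
      MvPolynomial.totalDegree_finsetSum_le fun i _ =>
        ((MvPolynomial.isHomogeneous_X ℝ i).pow 2).totalDegree_le
    simp_rw [hE]
    rw [hkey _ (hdeg2.trans (by norm_num)), hkey₀ _ (hdeg2.trans (by norm_num)),
      MvPolynomial.homogeneousComponent_eq_zero _ _ (lt_of_le_of_lt hdeg2 (by norm_num))]
    simp
  · -- mean dissipation
    obtain ⟨D, hDh, hD⟩ := exists_dissipationPoly hb hbo hbs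
    have hdegD : D.totalDegree ≤ 2 := hDh.totalDegree_le
    rw [ensembleDissipation_eq_integral_eval hD ν hlevμ, ensembleDissipation_eq_integral_eval hD ν hlev₀,
      hkey D (hdegD.trans (by norm_num)), hkey₀ D (hdegD.trans (by norm_num)),
      MvPolynomial.homogeneousComponent_eq_zero _ _ (lt_of_le_of_lt hdegD (by norm_num))]
    simp


/-- **S4 — EXACT FAR-ATOM SURGERY AT ORDER 4.** A level-`N` probability law `μ₀` with finite
fourth moments and STRICTLY positive degree-4 Riesz functional on `V_N` (band-form Slater),
3-stationary at `(ν,f,N)`, plus a defect certificate `(vₗ,cₗ)` for the cubic rows ⟹ a level-`N`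
probability law with finite fourth moments, 4-STATIONARY, with the same mean energy and
dissipation: `μ := (1−w)μ₁ + Σₗ cₗR⁻⁴·½(δ_{Rvₗ}+δ_{−Rvₗ})`, `μ₁` a level-`N` law with degree-4
coordinate moments `(1, M₁, M₂ − R⁻²Σcₗxₗxₗᵀ, M₃, M₄)(μ₀)/(1−w)` (strict positivity is open, so
Fialkow–Nie realises it for `R ≫ 1`); `μ` has moments exactly `(1, M₁, M₂, M₃, M₄(μ₀)+Σcₗxₗ^⊗4)`.
[folklore] -/
theorem stub_surgery :
    ∀ (ν : ℝ) (f : UnitAddTorus (Fin 3) → EuclideanSpace ℝ (Fin 3)) (N : ℕ) (μ₀ : Measure (Torus.energySpace (Fin 3))),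
    Torus.IsSmooth f → IsProbabilityMeasure μ₀ → (∀ᵐ u ∂μ₀, (∀ k ∉ (Torus.freqBall N).erase (0 : Fin 3 → ℤ),
          UnitAddTorus.mFourierCoeff (EuclideanSpace.complexify ∘ (u.1 : UnitAddTorus (Fin 3) → EuclideanSpace ℝ (Fin 3))) k = 0)) →
    Integrable (fun u : Torus.energySpace (Fin 3) => ‖u‖ ^ 4) μ₀ →
    (∀ (m : ℕ) (g : Fin m → UnitAddTorus (Fin 3) → EuclideanSpace ℝ (Fin 3))
      (P : MvPolynomial (Fin m) ℝ),
      (∀ i, (Torus.IsSmooth (g i) ∧ Torus.IsDivFree (g i) ∧ Torus.HasZeroMean (g i) ∧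
        ∀ k ∉ (Torus.freqBall N).erase (0 : Fin 3 → ℤ),
          UnitAddTorus.mFourierCoeff (EuclideanSpace.complexify ∘ (g i)) k = 0)) → P.totalDegree ≤ 4 →
      (∀ u : Torus.energySpace (Fin 3), (∀ k ∉ (Torus.freqBall N).erase (0 : Fin 3 → ℤ),
          UnitAddTorus.mFourierCoeff (EuclideanSpace.complexify ∘ (u.1 : UnitAddTorus (Fin 3) → EuclideanSpace ℝ (Fin 3))) k = 0) →
        0 ≤ MvPolynomial.eval (fun j => Torus.pairing u.1 (g j)) P) →
      (∃ u : Torus.energySpace (Fin 3), (∀ k ∉ (Torus.freqBall N).erase (0 : Fin 3 → ℤ),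
          UnitAddTorus.mFourierCoeff (EuclideanSpace.complexify ∘ (u.1 : UnitAddTorus (Fin 3) → EuclideanSpace ℝ (Fin 3))) k = 0) ∧
        MvPolynomial.eval (fun j => Torus.pairing u.1 (g j)) P ≠ 0) →
      0 < ∫ u, MvPolynomial.eval (fun j => Torus.pairing u.1 (g j)) P ∂μ₀) →
    (∀ (m : ℕ) (g : Fin m → UnitAddTorus (Fin 3) → EuclideanSpace ℝ (Fin 3))
      (P : MvPolynomial (Fin m) ℝ),
      (∀ i, (Torus.IsSmooth (g i) ∧ Torus.IsDivFree (g i) ∧ Torus.HasZeroMean (g i) ∧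
        ∀ k ∉ (Torus.freqBall N).erase (0 : Fin 3 → ℤ),
          UnitAddTorus.mFourierCoeff (EuclideanSpace.complexify ∘ (g i)) k = 0)) → P.totalDegree + 1 ≤ 3 →
      Integrable (fun u : Torus.energySpace (Fin 3) => Torus.nsGeneratorPairing ν f u
          (fun x => ∑ i, (MvPolynomial.eval (fun j => Torus.pairing u.1 (g j))
            (MvPolynomial.pderiv i P)) • g i x)) μ₀ ∧
      ∫ u, Torus.nsGeneratorPairing ν f u
          (fun x => ∑ i, (MvPolynomial.eval (fun j => Torus.pairing u.1 (g j))
            (MvPolynomial.pderiv i P)) • g i x) ∂μ₀ = 0) →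
    ∀ (M : ℕ) (v : Fin M → Torus.energySpace (Fin 3)) (c : Fin M → ℝ),
    ((∀ l, (∀ k ∉ (Torus.freqBall N).erase (0 : Fin 3 → ℤ),
          UnitAddTorus.mFourierCoeff (EuclideanSpace.complexify ∘ ((v l).1 : UnitAddTorus (Fin 3) → EuclideanSpace ℝ (Fin 3))) k = 0)) ∧ (∀ l, 0 ≤ c l) ∧
      ∀ (m : ℕ) (g : Fin m → UnitAddTorus (Fin 3) → EuclideanSpace ℝ (Fin 3))
      (P : MvPolynomial (Fin m) ℝ),
      (∀ i, (Torus.IsSmooth (g i) ∧ Torus.IsDivFree (g i) ∧ Torus.HasZeroMean (g i) ∧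
        ∀ k ∉ (Torus.freqBall N).erase (0 : Fin 3 → ℤ),
          UnitAddTorus.mFourierCoeff (EuclideanSpace.complexify ∘ (g i)) k = 0)) → P.IsHomogeneous 3 →
      ∫ u, Torus.nsGeneratorPairing ν f u
          (fun x => ∑ i, (MvPolynomial.eval (fun j => Torus.pairing u.1 (g j))
            (MvPolynomial.pderiv i P)) • g i x) ∂μ₀ +
        ∑ l, c l * Torus.nsGeneratorPairing (d := Fin 3) 0 0 (v l)
          (fun x => ∑ i, (MvPolynomial.eval (fun j => Torus.pairing (v l).1 (g j))
            (MvPolynomial.pderiv i P)) • g i x) = 0) →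
    ∃ μ : Measure (Torus.energySpace (Fin 3)), IsProbabilityMeasure μ ∧ (∀ᵐ u ∂μ, (∀ k ∉ (Torus.freqBall N).erase (0 : Fin 3 → ℤ),
          UnitAddTorus.mFourierCoeff (EuclideanSpace.complexify ∘ (u.1 : UnitAddTorus (Fin 3) → EuclideanSpace ℝ (Fin 3))) k = 0)) ∧
      Integrable (fun u : Torus.energySpace (Fin 3) => ‖u‖ ^ 4) μ ∧
      (∀ (m : ℕ) (g : Fin m → UnitAddTorus (Fin 3) → EuclideanSpace ℝ (Fin 3))
      (P : MvPolynomial (Fin m) ℝ),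
      (∀ i, (Torus.IsSmooth (g i) ∧ Torus.IsDivFree (g i) ∧ Torus.HasZeroMean (g i) ∧
        ∀ k ∉ (Torus.freqBall N).erase (0 : Fin 3 → ℤ),
          UnitAddTorus.mFourierCoeff (EuclideanSpace.complexify ∘ (g i)) k = 0)) → P.totalDegree + 1 ≤ 4 →
      Integrable (fun u : Torus.energySpace (Fin 3) => Torus.nsGeneratorPairing ν f u
          (fun x => ∑ i, (MvPolynomial.eval (fun j => Torus.pairing u.1 (g j))
            (MvPolynomial.pderiv i P)) • g i x)) μ ∧
      ∫ u, Torus.nsGeneratorPairing ν f u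
          (fun x => ∑ i, (MvPolynomial.eval (fun j => Torus.pairing u.1 (g j))
            (MvPolynomial.pderiv i P)) • g i x) ∂μ = 0) ∧
      Torus.ensembleEnergy μ = Torus.ensembleEnergy μ₀ ∧
      Torus.ensembleDissipation ν μ = Torus.ensembleDissipation ν μ₀ :=
  farAtomSurgery

end Summit.AnomalousDissipation.AnomalousDissipation.Theorems.MomentParityQuarticGate
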